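import Summits.QuantumFields.BalabanUV.Beta.KernelOrthoProjector

/-!
# `BalabanUV.Beta.KernelOrthoProjectorReindex` — binder row D1, JSB12SYM-SPINE v1.2 D-K4-3 (brick K1b-5, generic part): THE KERNEL PROJECTOR
# COMMUTES WITH REINDEXING and WITH RIGHT MULTIPLICATION BY AN ORTHOGONAL MATRIX

`kerProj (G.submatrix e f) = (kerProj G).submatrix f f` (equivalences `e`, `f`) and `kerProj (G * S) = Sᵀ * kerProj G * S` (`S Sᵀ = 1`): the two
[folklore] facts through which the permutation (`permK`) and reflection (`refK`, `N` odd) covariance of the symmetrised slice projector `symEc`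
(= `kerProj Gmat` blockwise) reduce to the covariance of the constraint matrix `Gmat` (memo `JSB12SYM-SPINE v1.2` §5.2 D-K4-3).
HONEST FRAMING (cell contract, verbatim): «discharging `BetaPertH` makes Bałaban's UV stability UNCONDITIONAL — a real constructive-QFT
result; it is NOT the continuum limit and NOT the Clay problem.»  Mathlib-only linear algebra; discharges NOTHING of row D1; JsB12Sym 0∕4 binders.
0 sorry, 0 `def`, nothing cited.  NOT D1, NOT BetaPertH, NOT continuum, NOT Clay.
HONEST DEPENDENCY (verbatim): «continuum YM on T⁴ ⇐ BetaPertH ∧ nine spine estimates (0/9 proved); BetaPertH ⇐ (D1) ∧ (D4) ∧ CAP+tail;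
G-an2-4 gates asym, D1 and NE2/3/4.»  Unit `b2b-balaban-beta-an2` gen 25 (row-D1 owner), 2026-08-21.
-/

namespace Summit.QuantumFields.BalabanUV.Beta.KernelOrthoProjectorReindex

open Matrix
open Summit.QuantumFields.BalabanUV.Beta.KernelOrthoProjector

variable {m n m' n' : Type*} [Fintype m] [Fintype n] [Fintype m'] [Fintype n'] [DecidableEq m] [DecidableEq n] [DecidableEq m'] [DecidableEq n']

/-- [folklore] **REINDEXING**: `kerProj (G.submatrix e f) = (kerProj G).submatrix f f` for equivalences `e`, `f`. -/
theorem kerProj_submatrix (G : Matrix m n ℝ) (e : m' ≃ m) (f : n' ≃ n) :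
    kerProj (G.submatrix e f) = (kerProj G).submatrix f f := by
  unfold kerProj
  have hT : (G.submatrix e f)ᵀ = Gᵀ.submatrix f e := transpose_submatrix _ _ _
  have hgram : G.submatrix e f * Gᵀ.submatrix f e = (G * Gᵀ).submatrix e e := submatrix_mul_equiv G Gᵀ e f e
  have hinv : ((G * Gᵀ).submatrix e e)⁻¹ = (G * Gᵀ)⁻¹.submatrix e e := inv_submatrix_equiv (G * Gᵀ) e e
  rw [hT, hgram, hinv, submatrix_mul_equiv Gᵀ (G * Gᵀ)⁻¹ f e e, submatrix_mul_equiv (Gᵀ * (G * Gᵀ)⁻¹) G f e f]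
  ext i j
  simp [Matrix.submatrix_apply, Matrix.one_apply]

/-- [folklore] **ORTHOGONAL RIGHT FACTOR**: `kerProj (G * S) = Sᵀ * kerProj G * S` when `S * Sᵀ = 1`. -/
theorem kerProj_mul_orthogonal (G : Matrix m n ℝ) (S : Matrix n n ℝ) (hS : S * Sᵀ = 1) :
    kerProj (G * S) = Sᵀ * kerProj G * S := by
  unfold kerProj
  have hS' : Sᵀ * S = 1 := by
    have := mul_eq_one_comm.mp hS
    exact this
  rw [transpose_mul, Matrix.mul_sub, Matrix.sub_mul, Matrix.mul_one, hS']
  congr 1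
  rw [show G * S * (Sᵀ * Gᵀ) = G * Gᵀ by rw [Matrix.mul_assoc, ← Matrix.mul_assoc S, hS, Matrix.one_mul]]
  simp only [Matrix.mul_assoc]

end Summit.QuantumFields.BalabanUV.Beta.KernelOrthoProjectorReindex
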